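import Literature.Computability.Complexity.UmansFPRootsFP
import Literature.Computability.Complexity.UmansLearnStep
import HarnessLib

/-!
# Umans' generator, machine level VII: Sudan's interpolation and the learning step on bitmask data

Literature / circuit complexity — derandomization. Seventh machine-level file of the tree's proof of
C. Umans, JCSS 2003, Thm. 6. On top of the null-vector program (`UmansFPLinear`), the univariate
toolkit (`UmansFPPolys`) and the root finder (`UmansFPRoots`), this file writes the decoding core of
the reconstruction procedure — Sudan's list recovery of a low-degree polynomial from position sets
(Umans, Lemma 15 / §6.2; Sudan 1997), then the coordinatewise learning step of Lemma 17 — as programs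
on bitmask data, and proves that on reduced data they compute the mathematical objects of
`UmansGoodCurves.lean` / `UmansLearnStep.lean`:

* `pairsL`, `rowOf`, `rowsL`, `chunksL`, **`interpL`** (Sudan's interpolant from the null vector of
  the linear system) with `interpL_spec`: nonzero, of shape `(I, J)`, vanishing at every pair;
* `agreeL` (`agreeL_eq_agree`), `candsL`, **`decodeCoordL`** with `polyOfList_decodeCoordL`:
  the program returns (a list reading as) `UmansRec.decodeCoord D A S nodes known`;
* **`learnL`**, **`stepL`** on tables (value functions `K → L` as lists of `L`-lists indexed by the
  bitmask of the argument; the predictor as a list-function parameter `gL`) with `learnL_spec`,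
  `stepL_spec`: under a faithful predictor (`PredOK`) and faithful coordinates (`CoordOK`) they
  compute `UmansRec.Ctx.learn` and `UmansRec.Ctx.step`.

Everything is proved; no named fact. The `CodeFP` certificates are in the next file.

## References

* C. Umans, *Pseudo-random generators for all hardnesses*, JCSS 67 (2003), Lemma 15, Lemma 17, §6.2 [Umans2003].
* M. Sudan, *Decoding of Reed Solomon codes beyond the error-correction bound*, J. Complexity 13 (1997), §2 [Sudan1997].
* R. M. Roth, G. Ruckenstein, IEEE Trans. Inform. Theory 46 (2000), §V–VI [RothRuckenstein2000].
-/

noncomputable section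

namespace Literature.Computability.Complexity

open Polynomial Finset Literature.InformationTheory.Coding Literature.InformationTheory.Coding.SudanRR
open Literature.InformationTheory.Coding.GF2X CodeFP
open Literature.LinearAlgebra.Matrix.ListGauss Literature.Computability.MetaComplexity
open scoped Polynomial.Bivariate

namespace UmansFP

/-! ### Sudan's linear system on a position table -/

/-- The power brick of `K` in the context `c` (unary exponent). [cite: KnuthTAOCP2, §4.6.3] -/
def cpow (c : ℕ × ℕ × ℕ) (a e : ℕ) : ℕ := GF2X.powMod c.1 c.2.1 c.2.2 c.1 a e

/-- In the context of `GF2 M`, `cpow` is `kpow`. [folklore] -/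
theorem cpow_kctx (M a e : ℕ) : cpow (kctx M) a e = kpow M a e := rfl

/-- **The constraint pairs** `(b, v)`, `v ∈ S_b`, of a position table `Sl` (row `b` of `Sl` lists
`S_b`), positions `b < q`. [cite: Sudan1997, §2] -/
def pairsL (q : ℕ) (Sl : List (List ℕ)) : List (ℕ × ℕ) :=
  (List.range q).flatMap fun b => (Sl.getD b []).map fun v => (b, v)

/-- **The row of the pair `(b, v)`**: the monomials `bⁱ vʲ` at the unknown `u = i + I j`.
[cite: Sudan1997, §2, Claim 3] -/
def rowOf (c : ℕ × ℕ × ℕ) (I n : ℕ) (bv : ℕ × ℕ) : List ℕ :=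
  (List.range n).map fun u => cmul c (cpow c bv.1 (u % I)) (cpow c bv.2 (u / I))

/-- The rows of Sudan's homogeneous system (`I · J` unknowns). [cite: Sudan1997, §2, Claim 3] -/
def rowsL (c : ℕ × ℕ × ℕ) (I J q : ℕ) (Sl : List (List ℕ)) : List (List ℕ) := (pairsL q Sl).map (rowOf c I (J * I))

/-- The coefficient vector cut into the `J` coefficient lists of `Y⁰, …, Y^{J-1}`. [folklore] -/
def chunksL (I J : ℕ) (w : List ℕ) : List (List ℕ) := (List.range J).map fun j => (w.drop (I * j)).take I

/-- **Sudan's interpolant** on bitmask data: a nonzero null vector of the system, cut into chunks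
(`[]` if the null-vector program fails, which it does not on valid inputs). [cite: Sudan1997, §2, Claim 3] -/
def interpL (c : ℕ × ℕ × ℕ) (I J q : ℕ) (Sl : List (List ℕ)) : List (List ℕ) :=
  match kerVecK c (J * I) (rowsL c I J q Sl) with
  | none => []
  | some w => chunksL I J w

section SudanSpec

variable (M : ℕ)

/-- **The position sets of a table**: `S_β = Sl[toBits β]` read in `K`. [cite: Umans2003, §6.2 (the sets `S_{j,b}`)] -/
def SOf (Sl : List (List ℕ)) (β : GF2 M) : Finset (GF2 M) := ((Sl.getD (toBits M β) []).map (GF2.elt M)).toFinset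

variable {M}

/-- Entries of `take`. [folklore] -/
theorem getD_take_of_lt {l : List ℕ} {n i : ℕ} (h : i < n) : (l.take n).getD i 0 = l.getD i 0 := by
  rw [List.getD_eq_getElem?_getD, List.getElem?_take, if_pos h, ← List.getD_eq_getElem?_getD]

/-- The `j`-th chunk. [folklore] -/
theorem chunksL_getD {I J : ℕ} (w : List ℕ) {j : ℕ} (hj : j < J) : (chunksL I J w).getD j [] = (w.drop (I * j)).take I := by
  rw [chunksL, List.getD_eq_getElem _ _ (by rw [List.length_map, List.length_range]; exact hj), List.getElem_map,
    List.getElem_range]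

/-- Entries of the chunks: the coefficient of `Xⁱ Yʲ` is `w[i + I j]`. [folklore] -/
theorem getD_chunksL {I J : ℕ} (w : List ℕ) {j i : ℕ} (hj : j < J) (hi : i < I) :
    ((chunksL I J w).getD j []).getD i 0 = w.getD (i + I * j) 0 := by
  rw [chunksL_getD w hj, getD_take_of_lt hi, List.getD_eq_getElem?_getD, List.getElem?_drop, ← List.getD_eq_getElem?_getD,
    Nat.add_comm]

/-- The chunks are reduced if `w` is. [folklore] -/
theorem KRedRows.chunksL {I J : ℕ} {w : List ℕ} (hw : KRed M w) : KRedRows M (chunksL I J w) := by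
  intro r hr
  obtain ⟨j, -, rfl⟩ := List.mem_map.1 hr
  exact fun x hx => hw x (List.mem_of_mem_drop (List.mem_of_mem_take hx))

/-- Coefficients of the interpolant read off the chunks. [folklore] -/
theorem coeff_coeff_bivOf_chunksL (M : ℕ) {I J : ℕ} (w : List ℕ) (j i : ℕ) :
    ((bivOf M (chunksL I J w)).coeff j).coeff i = if j < J ∧ i < I then GF2.elt M (w.getD (i + I * j) 0) else 0 := by
  have hlen : (chunksL I J w).length = J := by rw [chunksL, List.length_map, List.length_range]
  rw [coeff_bivOf, hlen]
  by_cases hj : j < J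
  · rw [if_pos hj, coeff_polyOfList]
    by_cases hi : i < I
    · rw [if_pos (show j < J ∧ i < I from ⟨hj, hi⟩), ← getD_chunksL w hj hi]
      split_ifs with h
      · rfl
      · rw [List.getD_eq_default _ _ (not_lt.1 h), GF2.elt, bitsPoly_zero, map_zero]
    · have hl : ((chunksL I J w).getD j []).length ≤ I := by
        rw [chunksL_getD w hj, List.length_take]; exact min_le_left _ _
      rw [if_neg (fun h => hi (lt_of_lt_of_le h hl)), if_neg (fun h => hi h.2)]
  · rw [if_neg hj, coeff_zero, if_neg (fun h => hj h.1)]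

/-- **Evaluation of the interpolant** at `(β, γ)`: `Σ_{j<J} Σ_{i<I} w[i + I j] βⁱ γʲ`. [folklore] -/
theorem evalEval_bivOf_chunksL (M : ℕ) {I J : ℕ} (w : List ℕ) (β γ : GF2 M) :
    (bivOf M (chunksL I J w)).evalEval β γ = ∑ j : Fin J, ∑ i : Fin I, GF2.elt M (w.getD (i + I * j) 0) * β ^ (i : ℕ) * γ ^ (j : ℕ) := by
  have hlen : (chunksL I J w).length = J := by rw [chunksL, List.length_map, List.length_range]
  rw [bivOf, hlen, evalEval_finsetSum, ← Fin.sum_univ_eq_sum_range]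
  refine Finset.sum_congr rfl fun j _ => ?_
  rw [evalEval_mul, evalEval_pow, evalEval_X, evalEval_C]
  -- the inner polynomial, by its coefficients
  set P := polyOfList M ((chunksL I J w).getD j []) with hP
  have hdeg : P.natDegree < I ∨ I = 0 := by
    rcases Nat.eq_zero_or_pos I with h0 | hpos
    · exact Or.inr h0
    · left
      have hl : ((chunksL I J w).getD j []).length ≤ I := by
        rw [chunksL_getD w j.2, List.length_take]; exact min_le_left _ _
      have := degree_polyOfList_lt M ((chunksL I J w).getD j [])
      by_cases hP0 : P = 0
      · rw [hP0, natDegree_zero]; exact hpos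
      · rw [hP, ← Nat.cast_lt (α := WithBot ℕ), ← degree_eq_natDegree hP0]
        exact this.trans_le (by exact_mod_cast hl)
  have hcoeff : ∀ i, P.coeff i = if i < I then GF2.elt M (w.getD (i + I * j) 0) else 0 := by
    intro i
    have := coeff_coeff_bivOf_chunksL M (I := I) (J := J) w j i
    rw [coeff_bivOf, hlen, if_pos j.2] at this
    rw [this]
    by_cases hi : i < I
    · rw [if_pos ⟨j.2, hi⟩, if_pos hi]
    · rw [if_neg (fun h => hi h.2), if_neg hi]
  rcases hdeg with hdeg | hI
  · rw [eval_eq_sum_range' hdeg, Finset.sum_mul, ← Fin.sum_univ_eq_sum_range]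
    refine Finset.sum_congr rfl fun i _ => ?_
    rw [hcoeff, if_pos i.2]
  · subst hI
    simp only [Finset.univ_eq_empty, Finset.sum_empty]
    have : P = 0 := by
      ext i; rw [hcoeff, if_neg (Nat.not_lt_zero _), coeff_zero]
    rw [this, eval_zero, zero_mul]

/-- The interpreted row of a pair. [folklore] -/
theorem castVec_rowOf {I n : ℕ} {b v : ℕ} (hb : b < 2 ^ (M + 1)) (hv : v < 2 ^ (M + 1)) :
    castVec M (rowOf (kctx M) I n (b, v)) = List.ofFn (fun u : Fin n => GF2.elt M b ^ ((u : ℕ) % I) * GF2.elt M v ^ ((u : ℕ) / I)) ∧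
      KRed M (rowOf (kctx M) I n (b, v)) ∧ (rowOf (kctx M) I n (b, v)).length = n := by
  have hent : ∀ u, GF2.elt M (cmul (kctx M) (cpow (kctx M) b (u % I)) (cpow (kctx M) v (u / I))) =
      GF2.elt M b ^ (u % I) * GF2.elt M v ^ (u / I) ∧ cmul (kctx M) (cpow (kctx M) b (u % I)) (cpow (kctx M) v (u / I)) < 2 ^ (M + 1) := by
    intro u
    obtain ⟨h1, h1'⟩ := kpow_spec M hb (u % I)
    obtain ⟨h2, h2'⟩ := kpow_spec M hv (u / I)
    obtain ⟨h3, h3'⟩ := kmul_spec M h1' h2'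
    rw [cmul_kctx, cpow_kctx, cpow_kctx, h3, h1, h2]
    exact ⟨rfl, h3'⟩
  refine ⟨?_, fun x hx => ?_, by rw [rowOf, List.length_map, List.length_range]⟩
  · apply List.ext_getElem
    · rw [length_castVec, rowOf, List.length_map, List.length_range, List.length_ofFn]
    · intro u h1 h2
      rw [List.length_ofFn] at h2
      rw [List.getElem_ofFn]
      simp only [castVec, rowOf, List.getElem_map, List.getElem_range]
      exact (hent u).1
  · obtain ⟨u, -, rfl⟩ := List.mem_map.1 hx
    exact (hent u).2

/-- Members of `pairsL`. [folklore] -/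
theorem mem_pairsL {q : ℕ} {Sl : List (List ℕ)} {bv : ℕ × ℕ} : bv ∈ pairsL q Sl ↔ bv.1 < q ∧ bv.2 ∈ Sl.getD bv.1 [] := by
  obtain ⟨b, v⟩ := bv
  simp only [pairsL, List.mem_flatMap, List.mem_range, List.mem_map, Prod.mk.injEq]
  constructor
  · rintro ⟨b', hb', v', hv', rfl, rfl⟩; exact ⟨hb', hv'⟩
  · rintro ⟨hb, hv⟩; exact ⟨b, hb, v, hv, rfl, rfl⟩

/-- The number of pairs is the total size of the table rows below `q`. [folklore] -/
theorem length_pairsL (q : ℕ) (Sl : List (List ℕ)) : (pairsL q Sl).length = ((List.range q).map fun b => (Sl.getD b []).length).sum := by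
  rw [pairsL, List.length_flatMap]
  simp

/-- `getD` through `map elt`. [folklore] -/
theorem getD_map_elt (M : ℕ) (l : List ℕ) (u : ℕ) : (l.map (GF2.elt M)).getD u 0 = GF2.elt M (l.getD u 0) := by
  rw [show (0 : GF2 M) = GF2.elt M 0 by rw [GF2.elt, bitsPoly_zero, map_zero], List.getD_map]

/-- **Sudan's interpolant on bitmask data is a genuine interpolant.** For a reduced position table
with fewer than `I · J` pairs below `q = 2^{M+1}`: `Q = bivOf (interpL …)` is nonzero, of shape
`(I, J)` with exactly `J` reduced coefficient rows, and vanishes at every `(β, v)`, `v ∈ S_β`.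
[cite: Sudan1997, §2, Claim 3; Umans2003, Lemma 15] -/
theorem interpL_spec {I J : ℕ} {Sl : List (List ℕ)} (hSl : KRedRows M Sl) (hcount : (pairsL (2 ^ (M + 1)) Sl).length < I * J) :
    bivOf M (interpL (kctx M) I J (2 ^ (M + 1)) Sl) ≠ 0 ∧ LDC.HasShape I J (bivOf M (interpL (kctx M) I J (2 ^ (M + 1)) Sl)) ∧
      (interpL (kctx M) I J (2 ^ (M + 1)) Sl).length = J ∧ KRedRows M (interpL (kctx M) I J (2 ^ (M + 1)) Sl) ∧
      ∀ β : GF2 M, ∀ v ∈ SOf M Sl β, (bivOf M (interpL (kctx M) I J (2 ^ (M + 1)) Sl)).evalEval β v = 0 := by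
  set Ql := interpL (kctx M) I J (2 ^ (M + 1)) Sl with hQldef
  set q := 2 ^ (M + 1) with hq
  set rows := rowsL (kctx M) I J q Sl with hrows
  -- the rows: reduced, of length `J I`, interpreting as the monomial rows
  have hpair : ∀ bv ∈ pairsL q Sl, bv.1 < 2 ^ (M + 1) ∧ bv.2 < 2 ^ (M + 1) := fun bv hbv => by
    obtain ⟨h1, h2⟩ := mem_pairsL.1 hbv
    exact ⟨h1, hSl.getD bv.1 _ h2⟩
  have hrowlen : ∀ r ∈ rows, r.length = J * I := fun r hr => by
    obtain ⟨bv, -, rfl⟩ := List.mem_map.1 hr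
    rw [rowOf, List.length_map, List.length_range]
  have hrowred : KRedRows M rows := fun r hr => by
    obtain ⟨⟨b, v⟩, hbv, rfl⟩ := List.mem_map.1 hr
    exact (castVec_rowOf (hpair _ hbv).1 (hpair _ hbv).2).2.1
  -- a nonzero solution exists (fewer equations than unknowns)
  set P := (pairsL q Sl).length with hP
  let A : Fin P → Fin (J * I) → GF2 M := fun t u =>
    GF2.elt M ((pairsL q Sl)[(t : ℕ)]'t.2).1 ^ ((u : ℕ) % I) * GF2.elt M ((pairsL q Sl)[(t : ℕ)]'t.2).2 ^ ((u : ℕ) / I)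
  obtain ⟨w, hw0, hw⟩ := LDC.exists_kernel_vec A (by rw [Nat.mul_comm]; exact hcount)
  have hsome : (kerVecK (kctx M) (J * I) rows).isSome = true := by
    refine kerVecK_complete hrowlen hrowred (List.ofFn w) (List.length_ofFn ..) ?_ fun r hr => ?_
    · obtain ⟨u, hu⟩ : ∃ u, w u ≠ 0 := by
        by_contra hall; push Not at hall; exact hw0 (funext hall)
      exact ⟨w u, List.mem_ofFn.2 ⟨u, rfl⟩, hu⟩
    · obtain ⟨t, ht, rfl⟩ := List.getElem_of_mem hr
      have ht' : t < P := by rw [hrows, rowsL, List.length_map] at ht; exact ht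
      have hmem : (pairsL q Sl)[t] ∈ pairsL q Sl := List.getElem_mem ht'
      obtain ⟨hc, -, -⟩ := castVec_rowOf (I := I) (n := J * I) (hpair _ hmem).1 (hpair _ hmem).2
      have : rows[t] = rowOf (kctx M) I (J * I) ((pairsL q Sl)[t].1, (pairsL q Sl)[t].2) := by
        rw [Prod.mk.eta]; simp [hrows, rowsL]
      rw [this, hc, dot_ofFn]
      exact hw ⟨t, ht'⟩
  -- the returned vector
  obtain ⟨w', hw'⟩ := Option.isSome_iff_exists.1 hsome
  obtain ⟨hlen, hred, ⟨x, hx, hx0⟩, horth⟩ := kerVecK_sound hrowlen hrowred hw'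
  have hQl : Ql = chunksL I J w' := by
    rw [hQldef, interpL, ← hrows, hw']
  have hJ : Ql.length = J := by rw [hQl, chunksL, List.length_map, List.length_range]
  -- vanishing at the pairs
  have hvan : ∀ bv ∈ pairsL q Sl, (bivOf M Ql).evalEval (GF2.elt M bv.1) (GF2.elt M bv.2) = 0 := by
    intro bv hbv
    obtain ⟨b, v⟩ := bv
    have hr : rowOf (kctx M) I (J * I) (b, v) ∈ rows := List.mem_map.2 ⟨(b, v), hbv, rfl⟩
    have h0 := horth _ hr
    obtain ⟨hc, -, -⟩ := castVec_rowOf (I := I) (n := J * I) (hpair _ hbv).1 (hpair _ hbv).2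
    rw [hc, castVec, ← ofFn_getD_eq (w'.map (GF2.elt M)) (by rw [List.length_map, hlen]), dot_ofFn] at h0
    rw [hQl, evalEval_bivOf_chunksL, ← Finset.sum_product', Finset.univ_product_univ, ← h0,
      ← Equiv.sum_comp finProdFinEquiv]
    refine Finset.sum_congr rfl fun ji _ => ?_
    obtain ⟨j, i⟩ := ji
    have hI : 0 < I := Fin.pos i
    have hu : ((finProdFinEquiv (j, i) : Fin (J * I)) : ℕ) = i + I * j := rfl
    dsimp only
    rw [hu, Nat.add_mul_mod_self_left, Nat.mod_eq_of_lt i.2, Nat.add_mul_div_left _ _ hI, Nat.div_eq_of_lt i.2,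
      zero_add, getD_map_elt]
    ring
  refine ⟨?_, ⟨?_, fun j => ?_⟩, hJ, by rw [hQl]; exact KRedRows.chunksL hred, fun β v hv => ?_⟩
  · -- nonzero: a nonzero entry of `w'` is a coefficient
    obtain ⟨u, hu, rfl⟩ := List.getElem_of_mem hx
    rw [hlen] at hu
    have hI : 0 < I := Nat.pos_of_ne_zero fun h => by rw [h, Nat.mul_zero] at hu; exact Nat.not_lt_zero _ hu
    have hj : u / I < J := Nat.div_lt_of_lt_mul (by rw [Nat.mul_comm]; exact hu)
    have hi : u % I < I := Nat.mod_lt _ hI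
    intro hQ0
    have hc := congrArg (fun Q : (GF2 M)[X][Y] => (Q.coeff (u / I)).coeff (u % I)) hQ0
    simp only [coeff_zero] at hc
    rw [hQl, coeff_coeff_bivOf_chunksL, if_pos ⟨hj, hi⟩, Nat.mod_add_div, List.getD_eq_getElem _ _ (by rw [hlen]; exact hu)] at hc
    exact hx0 hc
  · -- `Y`-degree `< J`
    refine (degree_lt_iff_coeff_zero _ _).2 fun m hm => ?_
    rw [coeff_bivOf, hJ, if_neg (by omega)]
  · -- `X`-degrees `< I`
    refine (degree_lt_iff_coeff_zero _ _).2 fun m hm => ?_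
    rw [hQl, coeff_coeff_bivOf_chunksL, if_neg (fun h => by omega)]
  · -- vanishing at `(β, v)`, `v ∈ S_β`
    obtain ⟨v', hv', rfl⟩ := List.mem_map.1 (List.mem_toFinset.1 hv)
    have hmem : (toBits M β, v') ∈ pairsL q Sl := mem_pairsL.2 ⟨toBits_lt M β, hv'⟩
    have := hvan _ hmem
    rwa [elt_toBits] at this

end SudanSpec

/-! ### Agreement, candidates, and the decoding of one coordinate -/

/-- **The agreement count** of the polynomial `f` with the table: positions `b < q` with
`f(b) ∈ S_b`. [cite: Sudan1997, §2 (the parameter `t`)] -/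
def agreeL (c : ℕ × ℕ × ℕ) (q : ℕ) (Sl : List (List ℕ)) (f : List ℕ) : ℕ :=
  ((List.range q).filter fun b => decide (keval c f b ∈ Sl.getD b [])).length

/-- **The candidate coefficient lists**: the paths of level `D + 1` of the root finder.
[cite: RothRuckenstein2000, §V] -/
def candsL (c : ℕ × ℕ × ℕ) (q cap D : ℕ) (Ql : List (List ℕ)) : List (List ℕ) :=
  (rrLevelsL c (List.range q) cap (D + 1) Ql).map Prod.fst

/-- The node-constraint test: `f(nodes_k) = known_k` for all `k`. [cite: Umans2003, §6.2] -/
def nodesOK (c : ℕ × ℕ × ℕ) (nodes known f : List ℕ) : Bool :=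
  (List.range nodes.length).all fun k => keval c f (nodes.getD k 0) == known.getD k 0

/-- **The survivors**: candidates with agreement `≥ A` taking the known values at the nodes.
[cite: Umans2003, §6.2] -/
def survL (c : ℕ × ℕ × ℕ) (q I J D A cap : ℕ) (Sl : List (List ℕ)) (nodes known : List ℕ) : List (List ℕ) :=
  (candsL c q cap D (interpL c I J q Sl)).filter fun f => decide (A ≤ agreeL c q Sl f) && nodesOK c nodes known f

/-- **Pick the unique survivor** (as a list; `[]` unless all survivors coincide and there is one).
[cite: Umans2003, §6.2 ("… the output polynomial with small agreement is unique")] -/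
def pickL (F : List (List ℕ)) : List ℕ :=
  match F with
  | [] => []
  | f :: rest => if rest.all (fun g => g == f) then f else []

/-- **Decoding one coordinate** on bitmask data. [cite: Umans2003, Lemma 17, §6.2] -/
def decodeCoordL (c : ℕ × ℕ × ℕ) (q I J D A cap : ℕ) (Sl : List (List ℕ)) (nodes known : List ℕ) : List ℕ :=
  pickL (survL c q I J D A cap Sl nodes known)

section DecodeSpec

variable {M : ℕ}

/-- `polyOfList` is injective on reduced lists of equal length. [folklore] -/
theorem polyOfList_injOn {u v : List ℕ} (hu : KRed M u) (hv : KRed M v) (hl : u.length = v.length)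
    (h : polyOfList M u = polyOfList M v) : u = v := by
  refine List.ext_getElem hl fun j h1 h2 => ?_
  have hc := congrArg (fun p : (GF2 M)[X] => p.coeff j) h
  simp only [coeff_polyOfList, if_pos h1, if_pos h2, List.getD_eq_getElem _ _ h1, List.getD_eq_getElem _ _ h2] at hc
  exact GF2.elt_injective (hu _ (List.getElem_mem h1)) (hv _ (List.getElem_mem h2)) hc

/-- A list of length `≤ D + 1` reads as a polynomial of degree `≤ D`. [folklore] -/
theorem natDegree_polyOfList_le {u : List ℕ} {D : ℕ} (h : u.length ≤ D + 1) : (polyOfList M u).natDegree ≤ D := by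
  rw [natDegree_le_iff_coeff_eq_zero]
  intro m hm
  rw [coeff_polyOfList, if_neg (by omega)]

/-- **The agreement count is the agreement** with the position sets of the table.
[cite: Sudan1997, §2] -/
theorem agreeL_eq_agree {Sl : List (List ℕ)} (hSl : KRedRows M Sl) {f : List ℕ} (hf : KRed M f) :
    agreeL (kctx M) (2 ^ (M + 1)) Sl f = SudanRR.agree (SOf M Sl) (polyOfList M f) := by
  classical
  have hel : ∀ b ∈ kelems M, b < 2 ^ (M + 1) := fun _ hb => List.mem_range.1 hb
  have hnd : ((kelems M).map (GF2.elt M)).Nodup :=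
    (List.nodup_map_iff_inj_on (nodup_kelems M)).2 fun a ha b hb hab => GF2.elt_injective (hel a ha) (hel b hb) hab
  have huniv : (Finset.univ : Finset (GF2 M)) = ((kelems M).map (GF2.elt M)).toFinset :=
    (Finset.eq_univ_iff_forall.2 fun x => List.mem_toFinset.2 (kelems_map_elt_perm M x)).symm
  -- the two tests agree on `[0, q)`
  have hagree : ∀ b ∈ kelems M, decide ((polyOfList M f).eval (GF2.elt M b) ∈ SOf M Sl (GF2.elt M b)) =
      decide (keval (kctx M) f b ∈ Sl.getD b []) := by
    intro b hb
    obtain ⟨hv, hlt⟩ := keval_spec (hel b hb) hf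
    rw [Bool.eq_iff_iff, decide_eq_true_eq, decide_eq_true_eq, SOf, toBits_elt M (hel b hb), List.mem_toFinset,
      List.mem_map, ← hv]
    constructor
    · rintro ⟨v, hvmem, hveq⟩
      rwa [← GF2.elt_injective (hSl.getD b v hvmem) hlt hveq]
    · intro hmem; exact ⟨_, hmem, rfl⟩
  -- the finset count as a list count
  have h1 : SudanRR.agree (SOf M Sl) (polyOfList M f) =
      (((kelems M).map (GF2.elt M)).filter fun β => decide ((polyOfList M f).eval β ∈ SOf M Sl β)).length := by
    rw [SudanRR.agree, huniv, ← List.toFinset_card_of_nodup (hnd.filter _), List.toFinset_filter]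
    congr 1
    exact Finset.filter_congr fun x _ => by simp
  rw [h1, List.filter_map, List.length_map, agreeL]
  congr 1
  exact List.filter_congr fun b hb => (hagree b hb).symm

/-- Members of `candsL` on valid data: reduced, of length `D + 1`. [folklore] -/
theorem mem_candsL {Ql : List (List ℕ)} (hQ : KRedRows M Ql) {cap D : ℕ} (hcap : max 1 (bivOf M Ql).natDegree ≤ cap)
    {p : List ℕ} (hp : p ∈ candsL (kctx M) (2 ^ (M + 1)) cap D Ql) : KRed M p ∧ p.length = D + 1 := by
  obtain ⟨nd, hnd, rfl⟩ := List.mem_map.1 hp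
  have hel : ∀ γ ∈ kelems M, γ < 2 ^ (M + 1) := fun _ hγ => List.mem_range.1 hγ
  have hnd' : ((kelems M).map (GF2.elt M)).Nodup :=
    (List.nodup_map_iff_inj_on (nodup_kelems M)).2 fun a ha b hb hab => GF2.elt_injective (hel a ha) (hel b hb) hab
  obtain ⟨h1, h2⟩ := map_rrLevelsL hel cap hQ (D + 1)
  refine ⟨(h2 nd hnd).1, ?_⟩
  have hmem : castNode M nd ∈ rrLevels ((kelems M).map (GF2.elt M)) cap (D + 1) (bivOf M Ql) := by
    rw [← h1]; exact List.mem_map.2 ⟨nd, hnd, rfl⟩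
  rw [rrLevels_eq_nodesL hnd' hcap] at hmem
  have := (mem_nodesL _ _ _ _ hmem).1
  rwa [castNode, List.length_map] at this

/-- The node test is the conjunction of the constraints. [folklore] -/
theorem nodesOK_iff {nodes known f : List ℕ} (hn : KRed M nodes) (hk : KRed M known) (hf : KRed M f) :
    nodesOK (kctx M) nodes known f = true ↔
      ∀ k, k < nodes.length → (polyOfList M f).eval (GF2.elt M (nodes.getD k 0)) = GF2.elt M (known.getD k 0) := by
  rw [nodesOK, List.all_eq_true]
  simp only [List.mem_range, beq_iff_eq]
  refine forall_congr' fun k => imp_congr_right fun hk' => ?_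
  obtain ⟨hv, hlt⟩ := keval_spec (hn.getD k) hf
  rw [← hv]
  exact ⟨fun h => by rw [h], fun h => GF2.elt_injective hlt (hk.getD k) h⟩

/-- `pickL` returns `[]` or a member. [folklore] -/
theorem pickL_mem_or : ∀ F : List (List ℕ), pickL F = [] ∨ pickL F ∈ F
  | [] => Or.inl rfl
  | f :: rest => by
    simp only [pickL]
    split_ifs
    · exact Or.inr List.mem_cons_self
    · exact Or.inl rfl

/-- **The survivors are exactly the constrained candidates.** For a reduced table with fewer than
`I J` pairs, `(I-1) + (J-1) D < A`, cap `≥ J`, and reduced node data: every survivor is reduced of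
length `D + 1`; a polynomial lies in `(cands D A S).filter (node constraints)` iff it is
`polyOfList` of a survivor; survivors reading as the same polynomial coincide; and there are at
most `max 1 cap` survivors. [cite: Umans2003, Lemma 15, §6.2; Sudan1997, §2, Thm. 5] -/
theorem survL_spec {I J D A cap r' : ℕ} {Sl : List (List ℕ)} (hSl : KRedRows M Sl)
    (hcount : (pairsL (2 ^ (M + 1)) Sl).length < I * J) (hA : (I - 1) + (J - 1) * D < A) (hcap : J ≤ cap)
    {nodes known : List ℕ} (hn : KRed M nodes) (hk : KRed M known) (hnl : nodes.length = r')
    (nodesK knownK : Fin r' → GF2 M) (hnK : ∀ k : Fin r', nodesK k = GF2.elt M (nodes.getD k 0))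
    (hkK : ∀ k : Fin r', knownK k = GF2.elt M (known.getD k 0)) :
    let F := survL (kctx M) (2 ^ (M + 1)) I J D A cap Sl nodes known
    (∀ p ∈ F, KRed M p ∧ p.length = D + 1) ∧
      (∀ f, f ∈ (UmansRec.cands D A (SOf M Sl)).filter (fun f => ∀ k : Fin r', f.eval (nodesK k) = knownK k) ↔
        ∃ p ∈ F, polyOfList M p = f) ∧
      (∀ p ∈ F, ∀ p' ∈ F, polyOfList M p = polyOfList M p' → p = p') ∧ F.length ≤ max 1 cap := by
  classical
  intro F
  obtain ⟨hQ0, hshape, hJ, hQred, hvan⟩ := interpL_spec (I := I) (J := J) hSl hcount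
  set Ql := interpL (kctx M) I J (2 ^ (M + 1)) Sl with hQl
  set Q := bivOf M Ql with hQdef
  have hIJ : 0 < I * J := lt_of_le_of_lt (Nat.zero_le _) hcount
  have hJpos : 1 ≤ J := Nat.pos_of_ne_zero fun h => by rw [h, Nat.mul_zero] at hIJ; exact lt_irrefl 0 hIJ
  have hdegQ : Q.natDegree < J := by
    have h1 := hshape.1
    rw [degree_eq_natDegree hQ0] at h1
    exact_mod_cast h1
  have hcap' : max 1 Q.natDegree ≤ cap := max_le (hJpos.trans hcap) (by omega)
  -- members of `F`: reduced of length `D + 1`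
  have hFmem : ∀ p ∈ F, KRed M p ∧ p.length = D + 1 := fun p hp => mem_candsL hQred hcap' (List.mem_filter.1 hp).1
  -- the node constraints, list form versus `Fin` form
  have hnodes : ∀ p, KRed M p → (nodesOK (kctx M) nodes known p = true ↔ ∀ k : Fin r', (polyOfList M p).eval (nodesK k) = knownK k) := by
    intro p hp
    rw [nodesOK_iff hn hk hp]
    constructor
    · intro h k; rw [hnK, hkK]; exact h k (by rw [hnl]; exact k.2)
    · intro h k hk'; have := h ⟨k, by rw [← hnl]; exact hk'⟩; rwa [hnK, hkK] at this
  refine ⟨hFmem, fun f => ?_, fun p hp p' hp' h =>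
    polyOfList_injOn (hFmem p hp).1 (hFmem p' hp').1 (by rw [(hFmem p hp).2, (hFmem p' hp').2]) h, ?_⟩
  · rw [Finset.mem_filter, UmansRec.mem_cands_iff]
    constructor
    · rintro ⟨⟨hdeg, hagr⟩, hcons⟩
      have hev : Q.eval f = 0 := eval_eq_zero_of_agree hshape hvan hdeg (lt_of_lt_of_le hA hagr)
      obtain ⟨nd, hnd, hndf⟩ := rrLevelsL_complete hQred hQ0 hcap' hdeg hev
      have hp : nd.1 ∈ candsL (kctx M) (2 ^ (M + 1)) cap D Ql := List.mem_map.2 ⟨nd, hnd, rfl⟩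
      obtain ⟨hpred, -⟩ := mem_candsL hQred hcap' hp
      refine ⟨nd.1, List.mem_filter.2 ⟨hp, ?_⟩, hndf⟩
      rw [Bool.and_eq_true, decide_eq_true_eq, agreeL_eq_agree hSl hpred, hndf, (hnodes _ hpred), hndf]
      exact ⟨hagr, hcons⟩
    · rintro ⟨p, hp, rfl⟩
      obtain ⟨hp1, hp2⟩ := List.mem_filter.1 hp
      obtain ⟨hpred, hplen⟩ := hFmem p hp
      rw [Bool.and_eq_true, decide_eq_true_eq, agreeL_eq_agree hSl hpred, hnodes _ hpred] at hp2
      exact ⟨⟨natDegree_polyOfList_le hplen.le, hp2.1⟩, hp2.2⟩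
  · refine (List.length_filter_le _ _).trans ?_
    rw [candsL, List.length_map]
    have := (rrLevelsL_inv (kctx M) (List.range (2 ^ (M + 1))) cap Ql (List.replicate (D + 1) ())).1
    rwa [rrLevelsL]

/-- **Decoding one coordinate computes `decodeCoord`.** For a reduced table with fewer than `I J`
pairs, `(I-1) + (J-1) D < A`, cap `≥ J`, reduced node data: the program's output reads as
`decodeCoord D A S nodes known` for the position sets `S = SOf Sl` and the node/value functions read
off the lists, and is reduced. [cite: Umans2003, Lemma 17, §6.2; Sudan1997, §2, Thm. 5] -/
theorem polyOfList_decodeCoordL {I J D A cap r' : ℕ} {Sl : List (List ℕ)} (hSl : KRedRows M Sl)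
    (hcount : (pairsL (2 ^ (M + 1)) Sl).length < I * J) (hA : (I - 1) + (J - 1) * D < A) (hcap : J ≤ cap)
    {nodes known : List ℕ} (hn : KRed M nodes) (hk : KRed M known) (hnl : nodes.length = r')
    (nodesK knownK : Fin r' → GF2 M) (hnK : ∀ k : Fin r', nodesK k = GF2.elt M (nodes.getD k 0))
    (hkK : ∀ k : Fin r', knownK k = GF2.elt M (known.getD k 0)) :
    polyOfList M (decodeCoordL (kctx M) (2 ^ (M + 1)) I J D A cap Sl nodes known) = UmansRec.decodeCoord D A (SOf M Sl) nodesK knownK ∧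
      KRed M (decodeCoordL (kctx M) (2 ^ (M + 1)) I J D A cap Sl nodes known) := by
  classical
  obtain ⟨hFmem, hTF', hinj, -⟩ := survL_spec hSl hcount hA hcap hn hk hnl nodesK knownK hnK hkK
  set F := survL (kctx M) (2 ^ (M + 1)) I J D A cap Sl nodes known with hF
  set T := (UmansRec.cands D A (SOf M Sl)).filter fun f => ∀ k : Fin r', f.eval (nodesK k) = knownK k with hT
  have hTF : ∀ f, f ∈ T ↔ ∃ p ∈ F, polyOfList M p = f := hTF'
  have hdec : UmansRec.decodeCoord D A (SOf M Sl) nodesK knownK = UmansRec.pickUnique T := rfl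
  refine ⟨?_, ?_⟩
  · rw [hdec, decodeCoordL, ← hF]
    -- case analysis on the survivors
    cases hFc : F with
    | nil =>
      have hT0 : T = ∅ := Finset.eq_empty_of_forall_notMem fun f hf => by
        obtain ⟨p, hp, -⟩ := (hTF f).1 hf; rw [hFc] at hp; simp at hp
      rw [pickL, polyOfList_nil, hT0, UmansRec.pickUnique, dif_neg (by simp)]
    | cons p rest =>
      have hpF : p ∈ F := by rw [hFc]; exact List.mem_cons_self
      by_cases hall : rest.all (fun g => g == p) = true
      · -- all survivors coincide: `T = {polyOfList p}`
        have hTeq : T = {polyOfList M p} := by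
          refine Finset.eq_singleton_iff_unique_mem.2 ⟨(hTF _).2 ⟨p, hpF, rfl⟩, fun f hf => ?_⟩
          obtain ⟨p', hp', rfl⟩ := (hTF f).1 hf
          rw [hFc, List.mem_cons] at hp'
          rcases hp' with rfl | hp'
          · rfl
          · rw [List.all_eq_true] at hall
            have := hall p' hp'; rw [beq_iff_eq] at this; rw [this]
        simp only [pickL, hall, ↓reduceIte]
        rw [hTeq, UmansRec.pickUnique_singleton]
      · -- two distinct survivors: `|T| ≠ 1`
        simp only [pickL, hall, Bool.false_eq_true, ↓reduceIte, polyOfList_nil]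
        rw [UmansRec.pickUnique, dif_neg]
        intro h1
        obtain ⟨f, hf⟩ := Finset.card_eq_one.1 h1
        apply hall
        rw [List.all_eq_true]
        intro g hg
        have hgF : g ∈ F := by rw [hFc]; exact List.mem_cons_of_mem p hg
        have e1 : polyOfList M g = f := Finset.mem_singleton.1 (hf ▸ (hTF _).2 ⟨g, hgF, rfl⟩)
        have e2 : polyOfList M p = f := Finset.mem_singleton.1 (hf ▸ (hTF _).2 ⟨p, hpF, rfl⟩)
        rw [beq_iff_eq]
        exact hinj g hgF p hpF (e1.trans e2.symm)
  · rcases pickL_mem_or F with h | h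
    · rw [decodeCoordL, ← hF, h]; exact KRed.nil
    · rw [decodeCoordL, ← hF]; exact (hFmem _ h).1

end DecodeSpec

/-! ### The learning step on tables -/

/-- **Learning along one curve on bitmask data.** Inputs: the window `Ws` (`n₀` tables, table `k`
listing the `L`-lists `W_k(b)`, `b < q`), the node positions, the known `L`-lists there, and the
predictor `gL` (a list of `n₀` `L`-lists ↦ the predicted `L`-lists). Output: the table of the
learned value function. [cite: Umans2003, Lemma 17, §6.2] -/
def learnL (c : ℕ × ℕ × ℕ) (q I J D A cap d : ℕ) (gL : List (List ℕ) → List (List ℕ))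
    (Ws : List (List (List ℕ))) (nodes : List ℕ) (knownLs : List (List ℕ)) : List (List ℕ) :=
  let predTab := (List.range q).map fun b => gL (Ws.map fun T => T.getD b [])
  let fs := (List.range d).map fun j =>
    decodeCoordL c q I J D A cap (predTab.map fun lst => lst.map fun u => u.getD j 0) nodes (knownLs.map fun u => u.getD j 0)
  (List.range q).map fun b => fs.map fun f => keval c f b

/-- **The interleaved step on bitmask data**: learn along `C₁` with the last table of `C₂`'s window
as the known values at the nodes `bnodes₁`, then along `C₂` with the values just learned at the
nodes `bnodes₀`. [cite: Umans2003, Lemma 17, §6.2] -/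
def stepL (c : ℕ × ℕ × ℕ) (q I J D A cap d n₀ : ℕ) (gL : List (List ℕ) → List (List ℕ))
    (bnodes₁ bnodes₀ : List ℕ) (Ws₁ Ws₂ : List (List (List ℕ))) : List (List ℕ) × List (List ℕ) :=
  let U₁ := learnL c q I J D A cap d gL Ws₁ bnodes₁ (bnodes₁.map fun x => (Ws₂.getD (n₀ - 1) []).getD x [])
  (U₁, learnL c q I J D A cap d gL Ws₂ bnodes₀ (bnodes₀.map fun x => U₁.getD x []))

section LearnSpec

variable {M : ℕ} {L : Type*} [Field L] [Algebra (GF2 M) L] [DecidableEq L]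
variable {d : ℕ} (X : UmansRec.Ctx (GF2 M) L) (N : Module.Basis (Fin d) (GF2 M) L) (D A : ℕ) (ρ : List ℕ → L)

/-- **Faithful coordinates**: on representing lists of length `d` with reduced entries, the
coordinates of `ρ u` in the basis `N` are the entries of `u`. [cite: Umans2003, §3] -/
def CoordOK (d : ℕ) (N : Module.Basis (Fin d) (GF2 M) L) (ρ : List ℕ → L) : Prop :=
  ∀ u : List ℕ, LRep M d u → ∀ j : Fin d, N.coord j (ρ u) = GF2.elt M (u.getD j 0)

/-- **Faithful predictor program**: on `n₀` representing lists, `gL` returns at most `ℓ₀`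
representing lists whose values form `g` of the represented window. [cite: Umans2003, §6.2] -/
def PredOK (d ℓ₀ : ℕ) (X : UmansRec.Ctx (GF2 M) L) (ρ : List ℕ → L) (gL : List (List ℕ) → List (List ℕ)) : Prop :=
  ∀ ws : List (List ℕ), ws.length = X.n₀ → (∀ u ∈ ws, LRep M d u) →
    (∀ u ∈ gL ws, LRep M d u) ∧ (gL ws).length ≤ ℓ₀ ∧ ((gL ws).map ρ).toFinset = X.g fun k => ρ (ws.getD k [])

/-- A table represents a value function. [folklore] -/
def TabOK (d : ℕ) (ρ : List ℕ → L) (T : List (List ℕ)) (U : GF2 M → L) : Prop :=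
  ∀ b, b < 2 ^ (M + 1) → LRep M d (T.getD b []) ∧ ρ (T.getD b []) = U (GF2.elt M b)

variable {X N D A ρ}

omit [DecidableEq L] in
/-- An element of `L` is determined by its coordinates. [folklore] -/
theorem eq_of_coord_eq {u v : L} (h : ∀ j : Fin d, N.coord j u = N.coord j v) : u = v :=
  N.ext_elem fun j => by simpa [Module.Basis.coord_apply] using h j

/-- **Correctness of `learnL`.** With a faithful predictor and faithful coordinates, windows
representing `W`, reduced nodes and known lists representing `knownL`, and Sudan's numeric
hypotheses (`q ℓ₀ < I J`, `(I-1) + (J-1) D < A`, `J ≤ cap`): the output table represents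
`X.learn N D A W nodes knownL`, and has `q` rows. [cite: Umans2003, Lemma 17, §6.2] -/
theorem learnL_spec {ℓ₀ I J cap r' : ℕ} {gL : List (List ℕ) → List (List ℕ)} (hN : CoordOK d N ρ) (hg : PredOK d ℓ₀ X ρ gL)
    (hIJ : 2 ^ (M + 1) * ℓ₀ < I * J) (hA : (I - 1) + (J - 1) * D < A) (hcap : J ≤ cap)
    {W : Fin X.n₀ → GF2 M → L} {Ws : List (List (List ℕ))} (hWl : Ws.length = X.n₀)
    (hW : ∀ k : Fin X.n₀, TabOK d ρ (Ws.getD k []) (W k))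
    {nodes : List ℕ} (hn : KRed M nodes) (hnl : nodes.length = r') (nodesK : Fin r' → GF2 M)
    (hnK : ∀ k : Fin r', nodesK k = GF2.elt M (nodes.getD k 0))
    {knownLs : List (List ℕ)} (knownL : Fin r' → L) (hkl : knownLs.length = r')
    (hk : ∀ k : Fin r', LRep M d (knownLs.getD k []) ∧ ρ (knownLs.getD k []) = knownL k) :
    TabOK d ρ (learnL (kctx M) (2 ^ (M + 1)) I J D A cap d gL Ws nodes knownLs) (X.learn N D A W nodesK knownL) ∧
      (learnL (kctx M) (2 ^ (M + 1)) I J D A cap d gL Ws nodes knownLs).length = 2 ^ (M + 1) := by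
  classical
  set q := 2 ^ (M + 1) with hq
  -- the window columns
  set col : ℕ → List (List ℕ) := fun b => Ws.map fun T => T.getD b [] with hcol
  have hcol_len : ∀ b, (col b).length = X.n₀ := fun b => by rw [hcol]; simp [hWl]
  have hcol_rep : ∀ b, b < q → ∀ u ∈ col b, LRep M d u := fun b hb u hu => by
    obtain ⟨T, hT, rfl⟩ := List.mem_map.1 hu
    obtain ⟨k, hk', rfl⟩ := List.getElem_of_mem hT
    have := (hW ⟨k, by rw [← hWl]; exact hk'⟩ b hb).1
    rwa [List.getD_eq_getElem _ _ hk'] at this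
  have hcol_val : ∀ b, b < q → (fun k : Fin X.n₀ => ρ ((col b).getD k [])) = fun k => W k (GF2.elt M b) := fun b hb => by
    funext k
    have hk' : (k : ℕ) < Ws.length := by rw [hWl]; exact k.2
    simp only [hcol]
    rw [List.getD_eq_getElem _ _ (by rw [List.length_map]; exact hk'), List.getElem_map, ← (hW k b hb).2,
      List.getD_eq_getElem _ _ hk']
  -- the predicted lists and the position tables
  set predTab := (List.range q).map fun b => gL (col b) with hpred
  set Slj : ℕ → List (List ℕ) := fun j => predTab.map fun lst => lst.map fun u => u.getD j 0 with hSlj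
  have hpred_b : ∀ b, b < q → predTab.getD b [] = gL (col b) := fun b hb => by
    rw [hpred, List.getD_eq_getElem _ _ (by rw [List.length_map, List.length_range]; exact hb), List.getElem_map, List.getElem_range]
  have hSlj_b : ∀ j b, b < q → (Slj j).getD b [] = (gL (col b)).map fun u => u.getD j 0 := fun j b hb => by
    rw [hSlj]
    simp only []
    rw [List.getD_eq_getElem _ _ (by rw [List.length_map, hpred, List.length_map, List.length_range]; exact hb), List.getElem_map,
      ← List.getD_eq_getElem _ [] (by rw [hpred, List.length_map, List.length_range]; exact hb), hpred_b b hb]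
  have hSlj_red : ∀ j : Fin d, KRedRows M (Slj j) := fun j r hr => by
    obtain ⟨lst, hlst, rfl⟩ := List.mem_map.1 hr
    obtain ⟨b, hb, rfl⟩ := List.mem_map.1 hlst
    intro x hx
    obtain ⟨u, hu, rfl⟩ := List.mem_map.1 hx
    exact ((hg (col b) (hcol_len b) (hcol_rep b (List.mem_range.1 hb))).1 u hu).getD_lt j
  -- the position sets are `posW`
  have hpos : ∀ j : Fin d, SOf M (Slj j) = X.posW N W j := by
    intro j
    funext β
    obtain ⟨b, hb, rfl⟩ : ∃ b, b < q ∧ GF2.elt M b = β := ⟨toBits M β, toBits_lt M β, elt_toBits M β⟩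
    obtain ⟨hrep, -, hset⟩ := hg (col b) (hcol_len _) (hcol_rep _ hb)
    rw [SOf, toBits_elt M hb, hSlj_b j _ hb, List.map_map, UmansRec.Ctx.posW, UmansRec.Ctx.predW, ← hcol_val _ hb, ← hset]
    ext y
    simp only [List.mem_toFinset, List.mem_map, Finset.mem_image, Function.comp_apply]
    constructor
    · rintro ⟨u, hu, rfl⟩; exact ⟨ρ u, ⟨u, hu, rfl⟩, hN u (hrep u hu) j⟩
    · rintro ⟨v, ⟨u, hu, rfl⟩, rfl⟩; exact ⟨u, hu, (hN u (hrep u hu) j).symm⟩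
  -- the pair count
  have hcount : ∀ j : Fin d, (pairsL q (Slj j)).length < I * J := fun j => by
    refine lt_of_le_of_lt ?_ hIJ
    rw [length_pairsL]
    have : ∀ x ∈ (List.range q).map (fun b => ((Slj j).getD b []).length), x ≤ ℓ₀ := fun x hx => by
      obtain ⟨b, hb, rfl⟩ := List.mem_map.1 hx
      rw [hSlj_b j b (List.mem_range.1 hb), List.length_map]
      exact (hg (col b) (hcol_len b) (hcol_rep b (List.mem_range.1 hb))).2.1
    have h2 := List.sum_le_card_nsmul _ _ this
    rw [List.length_map, List.length_range, smul_eq_mul] at h2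
    exact h2
  -- the coordinate polynomials
  set fj : ℕ → List ℕ := fun j => decodeCoordL (kctx M) q I J D A cap (Slj j) nodes (knownLs.map fun u => u.getD j 0) with hfj
  have hknown : ∀ j : Fin d, KRed M (knownLs.map fun u => u.getD j 0) ∧
      ∀ k : Fin r', N.coord j (knownL k) = GF2.elt M ((knownLs.map fun u => u.getD (j : ℕ) 0).getD k 0) := by
    intro j
    refine ⟨fun x hx => ?_, fun k => ?_⟩
    · obtain ⟨u, hu, rfl⟩ := List.mem_map.1 hx
      obtain ⟨i, hi, rfl⟩ := List.getElem_of_mem hu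
      have := (hk ⟨i, by rw [← hkl]; exact hi⟩).1
      rw [List.getD_eq_getElem _ _ hi] at this
      exact this.getD_lt j
    · have hk' : (k : ℕ) < knownLs.length := by rw [hkl]; exact k.2
      rw [List.getD_eq_getElem _ _ (by rw [List.length_map]; exact hk'), List.getElem_map, ← List.getD_eq_getElem _ [] hk',
        ← (hk k).2]
      exact hN _ (hk k).1 j
  have hfj : ∀ j : Fin d, polyOfList M (fj j) = UmansRec.decodeCoord D A (X.posW N W j) nodesK (fun k => N.coord j (knownL k)) ∧ KRed M (fj j) := by
    intro j
    have := polyOfList_decodeCoordL (hSlj_red j) (hcount j) hA hcap hn (hknown j).1 hnl nodesK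
      (fun k => N.coord j (knownL k)) hnK (hknown j).2
    rw [hpos j] at this
    exact this
  -- the output table
  refine ⟨fun b hb => ?_, by rw [learnL, List.length_map, List.length_range]⟩
  have hrow : (learnL (kctx M) q I J D A cap d gL Ws nodes knownLs).getD b [] = (List.range d).map fun j => keval (kctx M) (fj j) b := by
    rw [learnL, List.getD_eq_getElem _ _ (by rw [List.length_map, List.length_range]; exact hb), List.getElem_map, List.getElem_range,
      List.map_map]
    rfl
  have hent : ∀ j : Fin d, ((List.range d).map fun j => keval (kctx M) (fj j) b).getD j 0 = keval (kctx M) (fj j) b := fun j => by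
    rw [List.getD_eq_getElem _ _ (by rw [List.length_map, List.length_range]; exact j.2), List.getElem_map, List.getElem_range]
  have hrep : LRep M d ((List.range d).map fun j => keval (kctx M) (fj j) b) := by
    refine ⟨by rw [List.length_map, List.length_range], fun x hx => ?_⟩
    obtain ⟨j, hj, rfl⟩ := List.mem_map.1 hx
    exact (keval_spec hb (hfj ⟨j, List.mem_range.1 hj⟩).2).2
  rw [hrow]
  refine ⟨hrep, eq_of_coord_eq (N := N) fun j => ?_⟩
  rw [hN _ hrep j, hent j, (keval_spec hb (hfj j).2).1, (hfj j).1, UmansRec.Ctx.learn,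
    UmansRec.assemble, map_sum]
  simp only [map_smul, Module.Basis.coord_apply, Module.Basis.repr_self, Finsupp.single_apply, smul_eq_mul, mul_ite, mul_one,
    mul_zero, Finset.sum_ite_eq', Finset.mem_univ, ↓reduceIte]

/-- **Correctness of `stepL`** (the interleaved step): with both windows represented and the node
lists `bnodes₁`, `bnodes₀` listing `b(lev d c, ·)`, `b(0, ·)`, the two output tables represent the
two components of `X.step N D A hn b c W₁ W₂`. [cite: Umans2003, Lemma 17] -/
theorem stepL_spec {ℓ₀ I J cap r' : ℕ} {gL : List (List ℕ) → List (List ℕ)} (hN : CoordOK d N ρ) (hg : PredOK d ℓ₀ X ρ gL)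
    (hIJ : 2 ^ (M + 1) * ℓ₀ < I * J) (hA : (I - 1) + (J - 1) * D < A) (hcap : J ≤ cap) (hn : 0 < X.n₀)
    (b : UmansRec.Idx d r' ↪ GF2 M) (c : ℕ)
    {bnodes₁ bnodes₀ : List ℕ} (hb₁l : bnodes₁.length = r') (hb₀l : bnodes₀.length = r')
    (hb₁ : ∀ k : Fin r', bnodes₁.getD k 0 < 2 ^ (M + 1) ∧ GF2.elt M (bnodes₁.getD k 0) = b (UmansRec.lev d c, k))
    (hb₀ : ∀ k : Fin r', bnodes₀.getD k 0 < 2 ^ (M + 1) ∧ GF2.elt M (bnodes₀.getD k 0) = b (0, k))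
    {W₁ W₂ : Fin X.n₀ → GF2 M → L} {Ws₁ Ws₂ : List (List (List ℕ))} (hW₁l : Ws₁.length = X.n₀) (hW₂l : Ws₂.length = X.n₀)
    (hW₁ : ∀ k : Fin X.n₀, TabOK d ρ (Ws₁.getD k []) (W₁ k)) (hW₂ : ∀ k : Fin X.n₀, TabOK d ρ (Ws₂.getD k []) (W₂ k)) :
    TabOK d ρ (stepL (kctx M) (2 ^ (M + 1)) I J D A cap d X.n₀ gL bnodes₁ bnodes₀ Ws₁ Ws₂).1 (X.step N D A hn b c W₁ W₂).1 ∧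
      TabOK d ρ (stepL (kctx M) (2 ^ (M + 1)) I J D A cap d X.n₀ gL bnodes₁ bnodes₀ Ws₁ Ws₂).2 (X.step N D A hn b c W₁ W₂).2 := by
  have hred₁ : KRed M bnodes₁ := fun x hx => by
    obtain ⟨i, hi, rfl⟩ := List.getElem_of_mem hx
    have := (hb₁ ⟨i, by rw [← hb₁l]; exact hi⟩).1; rwa [List.getD_eq_getElem _ _ hi] at this
  have hred₀ : KRed M bnodes₀ := fun x hx => by
    obtain ⟨i, hi, rfl⟩ := List.getElem_of_mem hx
    have := (hb₀ ⟨i, by rw [← hb₀l]; exact hi⟩).1; rwa [List.getD_eq_getElem _ _ hi] at this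
  -- first half: along `C₁`, known values from the last table of `C₂`'s window
  have hlast : TabOK d ρ (Ws₂.getD (X.n₀ - 1) []) (W₂ ⟨X.n₀ - 1, by omega⟩) := hW₂ ⟨X.n₀ - 1, by omega⟩
  have hk₁ : ∀ k : Fin r', LRep M d ((bnodes₁.map fun x => (Ws₂.getD (X.n₀ - 1) []).getD x []).getD k []) ∧
      ρ ((bnodes₁.map fun x => (Ws₂.getD (X.n₀ - 1) []).getD x []).getD k []) = W₂ ⟨X.n₀ - 1, by omega⟩ (b (UmansRec.lev d c, k)) := by
    intro k
    have hk' : (k : ℕ) < bnodes₁.length := by rw [hb₁l]; exact k.2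
    rw [List.getD_eq_getElem _ _ (by rw [List.length_map]; exact hk'), List.getElem_map, ← List.getD_eq_getElem _ 0 hk']
    obtain ⟨hlt, hval⟩ := hb₁ k
    obtain ⟨h1, h2⟩ := hlast _ hlt
    exact ⟨h1, by rw [h2, hval]⟩
  obtain ⟨hU₁, -⟩ := learnL_spec (X := X) (N := N) (D := D) (A := A) hN hg hIJ hA hcap hW₁l hW₁ hred₁ hb₁l
    (fun k => b (UmansRec.lev d c, k)) (fun k => (hb₁ k).2.symm) (fun k => W₂ ⟨X.n₀ - 1, by omega⟩ (b (UmansRec.lev d c, k)))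
    (by rw [List.length_map, hb₁l]) hk₁
  set U₁ := learnL (kctx M) (2 ^ (M + 1)) I J D A cap d gL Ws₁ bnodes₁ (bnodes₁.map fun x => (Ws₂.getD (X.n₀ - 1) []).getD x []) with hU₁def
  set U₁m := X.learn N D A W₁ (fun k => b (UmansRec.lev d c, k)) (fun k => W₂ ⟨X.n₀ - 1, by omega⟩ (b (UmansRec.lev d c, k))) with hU₁m
  -- second half: along `C₂`, known values just learned
  have hk₀ : ∀ k : Fin r', LRep M d ((bnodes₀.map fun x => U₁.getD x []).getD k []) ∧
      ρ ((bnodes₀.map fun x => U₁.getD x []).getD k []) = U₁m (b (0, k)) := by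
    intro k
    have hk' : (k : ℕ) < bnodes₀.length := by rw [hb₀l]; exact k.2
    rw [List.getD_eq_getElem _ _ (by rw [List.length_map]; exact hk'), List.getElem_map, ← List.getD_eq_getElem _ 0 hk']
    obtain ⟨hlt, hval⟩ := hb₀ k
    obtain ⟨h1, h2⟩ := hU₁ _ hlt
    exact ⟨h1, by rw [h2, hval]⟩
  obtain ⟨hU₂, -⟩ := learnL_spec (X := X) (N := N) (D := D) (A := A) hN hg hIJ hA hcap hW₂l hW₂ hred₀ hb₀l
    (fun k => b (0, k)) (fun k => (hb₀ k).2.symm) (fun k => U₁m (b (0, k))) (by rw [List.length_map, hb₀l]) hk₀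
  exact ⟨hU₁, hU₂⟩

end LearnSpec

end UmansFP

end Literature.Computability.Complexity

end
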